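import Summits.ResolutionOfSingularities.ResolutionOfSingularities.Theorems.EquisingularLiftEquisingularLiftNatModelPointStep
import HarnessLib

/-!
# [OURS · L1 W4.5(b) · EL♮ T-ISO-0⁺] THE MODEL POINT STEP IN CHAIN CURRENCY (kit K3b of res-D-pv-029's T-ISO-0⁺,
# res-L1-w45b-plan-1 ORDERS AMENDMENT 2 (c) 2026-08-27)

Crux `EquisingularLiftNat` = stmt-ResolutionOfSingularities-20038 (route EquisingularLift), line `sections`; helper file
`--supports … --as helper`. HONEST FRAMING: OURS (cell res-hironaka, slot W4.5(b)); NOT a statement of any manuscript; AI-written,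
weaker than expert review. No `sorry`; standard axioms.

`modelPointStep` (K3, p510112) asks three things of the downstairs point `x ∈ T`: closed with the ambient regular at `x`, `T ⊄ {x}`,
and `σ' (j x)` not the generic point of `Y`. When the stage predicate `Ch` implies the item's `Split.Chain` (as along EL♮) and `x` is a
NON-REGULAR point of the reduced strict transform `V(closure T)_red` (the currency of T-ISO-0's downstairs chains), the last two are
automatic; this file packages that, together with the bookkeeping the Δ-step needs next:

* `isIrreducible_of_model` — a downstairs closed set `T₂` with `j₂ '' T₂ = S''` for a `Chain`-stage `(X'', σ'', S'')` is irreducible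
  (`S''` is the closure of the point over the generic point of `Y`, `Split.Chain.fibre`; transport through
  `V_F(T₂)_red ≅ V_X(j₂ '' T₂)_red`, `exists_iso_subscheme_vanishingIdeal_image`);
* `modelPointStep_chain` — INPUT: a `Ch`-stage with its model square `j : F₁ → X'`, `j '' T₁ = S'`, `T₁` closed irreducible, `F₁`
  integral, a point `x` of `V(closure T₁)_red` closed in `F₁`, non-regular there, with `F₁` regular at `x`, and a blow-up `υ : F₂ → F₁`
  of the reduced point. OUTPUT: `F₂` integral, the new strict-transform set irreducible, and the section data `(U, s, τ : X'' → X')`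
  with: `U` smooth ∋ `s(𝔪)`, `supp (ker s)` over non-generic points of `Y`, the CARRIER IDENTITY
  `(ker s · 𝒪_{X''}) · 𝒪_{F₂} = 𝔪_x · 𝒪_{F₂}` (the upstairs exceptional ideal restricts to the downstairs one), the new `Ch`-stage on
  `j₂ '' T₂`, `X''` integral regular locally Noetherian dominant over `O`, and the new model square `j₂`.

References: …NatModelPointStep.lean (p510112), …NatModelStep.lean (p509016), …NatPointStep.lean (p505032).
-/

set_option linter.dupNamespace false -- mandated namespace `Summit.<Summit>.<Problem>` of this single-conjunct summit
set_option linter.overlappingInstances false -- signatures carry `[IsDomain O] [IsDiscreteValuationRing O]`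

noncomputable section

open CategoryTheory CategoryTheory.Limits AlgebraicGeometry TopologicalSpace Topology
open Literature.AlgebraicGeometry.Resolution
open AlgebraicGeometry.Scheme.IdealSheafData
open Summit.ResolutionOfSingularities.ResolutionOfSingularities.Theses.EquisingularLift.Split
open Summit.ResolutionOfSingularities.ResolutionOfSingularities.Cruxes.EquisingularLift.StrataSplit

namespace Summit.ResolutionOfSingularities.ResolutionOfSingularities.Cruxes.EquisingularLiftNat.Sections

/-! ## Two small topological lemmas -/

/-- A point of a closed set which is not its generic point is not all of it. [folklore] -/
theorem not_subset_singleton_of_not_isGenericPoint {X : Type*} [TopologicalSpace X] {T : Set X} {x : X}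
    (hT : IsClosed T) (hx : x ∈ T) (hgen : ¬ IsGenericPoint x T) : ¬ T ⊆ {x} := by
  intro h
  have hTx : T = {x} := Set.Subset.antisymm h (Set.singleton_subset_iff.mpr hx)
  apply hgen
  rw [isGenericPoint_def, hTx]
  exact (hTx ▸ hT : IsClosed ({x} : Set X)).closure_eq

/-- Generic points are detected through a closed embedding. [folklore] -/
theorem isGenericPoint_of_isClosedEmbedding {X Y : Type*} [TopologicalSpace X] [TopologicalSpace Y] {f : X → Y}
    (hf : IsClosedEmbedding f) {x : X} {T : Set X} (h : IsGenericPoint (f x) (f '' T)) : IsGenericPoint x T := by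
  rw [isGenericPoint_def] at h ⊢
  apply hf.injective.image_injective
  rw [← hf.closure_image_eq, Set.image_singleton, h]

/-! ## Irreducibility of downstairs strict transforms through a model -/

/-- **A downstairs closed set modelling the strict-transform set of a `Chain`-stage is irreducible.** [folklore] -/
theorem isIrreducible_of_model {P : Scheme.{0}} {Y : Set P} (hYirr : IsIrreducible Y) (hYcl : IsClosed Y)
    {F₂ X'' : Scheme.{0}} {σ'' : X'' ⟶ P} {S'' : Set X''} (hch : Chain P Y X'' σ'' S'')
    (j₂ : F₂ ⟶ X'') [IsClosedImmersion j₂] (T₂ : Set F₂) (hT₂cl : IsClosed T₂) (hsets : j₂ '' T₂ = S'') :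
    IsIrreducible T₂ := by
  obtain ⟨ξ, hξ⟩ : ∃ ξ : P, IsGenericPoint ξ Y := QuasiSober.sober hYirr hYcl
  obtain ⟨ξ'', -, hS''⟩ := Chain.fibre hch hξ
  have hT₂cl' : IsClosed (j₂ '' T₂) := j₂.isClosedEmbedding.isClosedMap _ hT₂cl
  have hirr2 : IsIrreducible (j₂ '' T₂) := by rw [hsets, hS'']; exact isIrreducible_singleton.closure
  obtain ⟨e₂, -⟩ := exists_iso_subscheme_vanishingIdeal_image j₂ ⟨T₂, hT₂cl⟩ hT₂cl'
  haveI : IsIntegral (vanishingIdeal (⟨j₂ '' T₂, hT₂cl'⟩ : Closeds X'')).subscheme :=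
    ComponentGluing.isIntegral_subscheme_vanishingIdeal _ hirr2
  haveI : IsIntegral (vanishingIdeal (⟨T₂, hT₂cl⟩ : Closeds F₂)).subscheme := IsIntegral.of_isIso e₂.inv
  have hr : Set.range (vanishingIdeal (⟨T₂, hT₂cl⟩ : Closeds F₂)).subschemeι = T₂ := by
    rw [range_subschemeι, coe_support_vanishingIdeal]; rfl
  rw [← hr, ← Set.image_univ]
  exact (IrreducibleSpace.isIrreducible_univ _).image _ (Scheme.Hom.continuous _).continuousOn

/-! ## The model point step in chain currency -/

/-- **THE MODEL POINT STEP, chain currency** (see the module docstring). [cite: Liu2002, §8.1 and Thm. 8.1.19] -/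
theorem modelPointStep_chain (O : Type) [CommRing O] [IsDomain O] [IsDiscreteValuationRing O]
    [IsAdicComplete (IsLocalRing.maximalIdeal O) O] [IsAlgClosed (IsLocalRing.ResidueField O)]
    (k : Type) [Field k] (θ : O →+* k) (hθ : Function.Surjective θ)
    (P : Scheme.{0}) (q : P ⟶ Spec (.of O)) (Y : Set P) (hY : Y ⊆ q ⁻¹' {IsLocalRing.closedPoint O})
    (hYirr : IsIrreducible Y) (hYcl : IsClosed Y) (hPnoeth : IsLocallyNoetherian P) (hPreg : Scheme.IsRegular P) [IsProper q]
    (Ch : ∀ X' : Scheme.{0}, (X' ⟶ P) → Set X' → Prop)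
    (hChain : ∀ (X' : Scheme.{0}) (σ : X' ⟶ P) (S : Set X'), Ch X' σ S → Chain P Y X' σ S)
    (hStep : ∀ (X' X'' : Scheme.{0}) (σ' : X' ⟶ P) (S' : Set X') (C : X'.IdealSheafData) (τ : X'' ⟶ X'),
      Ch X' σ' S' → IsBlowup τ C → Scheme.IsRegular C.subscheme → Flat (C.subschemeι ≫ σ' ≫ q) →
      σ' '' (C.support : Set X') ⊆ {x : P | ¬ IsGenericPoint x Y} →
      (C.support : Set X') ∩ (σ' ≫ q) ⁻¹' {IsLocalRing.closedPoint O} ⊆ S' →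
      Ch X'' (τ ≫ σ') (closure (τ ⁻¹' (S' \ (C.support : Set X')))))
    -- the upstairs stage
    (X' : Scheme.{0}) (σ' : X' ⟶ P) (S' : Set X') (hCh : Ch X' σ' S')
    [IsIntegral X'] [IsLocallyNoetherian X'] (hreg : Scheme.IsRegular X') (hdom : IsDominant (σ' ≫ q))
    -- the downstairs stage and the model square
    (F₁ : Scheme.{0}) [IsIntegral F₁] (j : F₁ ⟶ X') (t : F₁ ⟶ Spec (.of k))
    (hsq : IsPullback j t (σ' ≫ q) (Spec.map (CommRingCat.ofHom θ)))
    (T₁ : Set F₁) (hT₁cl : IsClosed T₁) (hT₁irr : IsIrreducible T₁) (hTS : j '' T₁ = S')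
    -- the point
    (x : ↥(vanishingIdeal (⟨closure T₁, isClosed_closure⟩ : Closeds F₁)).subscheme)
    (hx : IsClosed ({((vanishingIdeal (⟨closure T₁, isClosed_closure⟩ : Closeds F₁)).subschemeι x : F₁)} : Set F₁))
    (hxreg : ¬ IsRegularLocalRing ((vanishingIdeal (⟨closure T₁, isClosed_closure⟩ : Closeds F₁)).subscheme.presheaf.stalk x))
    (hFreg : IsRegularLocalRing (F₁.presheaf.stalk ((vanishingIdeal (⟨closure T₁, isClosed_closure⟩ : Closeds F₁)).subschemeι x)))
    -- the downstairs blow-up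
    (F₂ : Scheme.{0}) (υ : F₂ ⟶ F₁)
    (hυ : IsBlowup υ (vanishingIdeal ⟨{((vanishingIdeal (⟨closure T₁, isClosed_closure⟩ : Closeds F₁)).subschemeι x : F₁)}, hx⟩)) :
    IsIntegral F₂ ∧
    IsIrreducible (closure (υ ⁻¹' (T₁ \ {((vanishingIdeal (⟨closure T₁, isClosed_closure⟩ :
      Closeds F₁)).subschemeι x : F₁)}))) ∧
    ∃ (U : X'.Opens) (s : Spec (.of O) ⟶ X') (X'' : Scheme.{0}) (τ : X'' ⟶ X') (j₂ : F₂ ⟶ X'') (t₂ : F₂ ⟶ Spec (.of k)),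
      IsProper (σ' ≫ q) ∧ Smooth (U.ι ≫ σ' ≫ q) ∧ s ≫ σ' ≫ q = 𝟙 _ ∧ s (IsLocalRing.closedPoint O) ∈ U ∧
      (∀ c ∈ (s.ker.support : Set X'), ¬ IsGenericPoint (σ' c) Y) ∧
      IsBlowup τ s.ker ∧
      (s.ker.comap τ).comap j₂ = (vanishingIdeal ⟨{((vanishingIdeal (⟨closure T₁, isClosed_closure⟩ :
        Closeds F₁)).subschemeι x : F₁)}, hx⟩).comap υ ∧
      Ch X'' (τ ≫ σ') (j₂ '' closure (υ ⁻¹' (T₁ \ {((vanishingIdeal (⟨closure T₁, isClosed_closure⟩ :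
        Closeds F₁)).subschemeι x : F₁)}))) ∧
      IsIntegral X'' ∧ IsLocallyNoetherian X'' ∧ Scheme.IsRegular X'' ∧ IsDominant ((τ ≫ σ') ≫ q) ∧
      IsPullback j₂ t₂ ((τ ≫ σ') ≫ q) (Spec.map (CommRingCat.ofHom θ)) := by
  classical
  set xF : F₁ := (vanishingIdeal (⟨closure T₁, isClosed_closure⟩ : Closeds F₁)).subschemeι x with hxF
  have hclT₁ : closure T₁ = T₁ := hT₁cl.closure_eq
  have hT₁irr' : IsIrreducible (closure T₁) := by rw [hclT₁]; exact hT₁irr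
  haveI : IsClosedImmersion (Spec.map (CommRingCat.ofHom θ)) := IsClosedImmersion.spec_of_surjective _ hθ
  -- `xF ∈ T₁` is not the generic point of `T₁`
  have hrangeι : Set.range (vanishingIdeal (⟨closure T₁, isClosed_closure⟩ : Closeds F₁)).subschemeι = closure T₁ := by
    rw [range_subschemeι, coe_support_vanishingIdeal]; rfl
  have hxT : xF ∈ T₁ := by
    rw [← hclT₁, ← hrangeι]; exact ⟨x, rfl⟩
  have hxgen : ¬ IsGenericPoint xF T₁ := by
    have h := not_isGenericPoint_of_not_isRegularLocalRing (⟨closure T₁, isClosed_closure⟩ : Closeds F₁) hT₁irr' x hxreg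
    rwa [show ((⟨closure T₁, isClosed_closure⟩ : Closeds F₁) : Set F₁) = T₁ from hclT₁] at h
  have hTx : ¬ T₁ ⊆ {xF} := not_subset_singleton_of_not_isGenericPoint hT₁cl hxT hxgen
  -- upstairs chain facts
  have hch : Chain P Y X' σ' S' := hChain _ _ _ hCh
  obtain ⟨-, -, hσ'⟩ := chain_isRegular P Y X' σ' S' hch hPnoeth hPreg
  haveI := hσ'
  have hproper : IsProper (σ' ≫ q) := inferInstance
  haveI hjci : IsClosedImmersion j := MorphismProperty.IsStableUnderBaseChange.of_isPullback hsq.flip inferInstance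
  -- `σ' (j xF)` is not the generic point of `Y`
  obtain ⟨ξ, hξ⟩ : ∃ ξ : P, IsGenericPoint ξ Y := QuasiSober.sober hYirr hYcl
  obtain ⟨ξ', hfib', hS'⟩ := Chain.fibre hch hξ
  have hw : ¬ IsGenericPoint (σ' (j xF)) Y := by
    intro hgen
    have h1 : σ' (j xF) = ξ := hgen.eq hξ
    have h2 : j xF = ξ' := by
      have : j xF ∈ σ' ⁻¹' {ξ} := h1
      rw [hfib'] at this
      simpa using this
    have h3 : IsGenericPoint (j xF) (j '' T₁) := by
      rw [hTS, h2, isGenericPoint_def, hS']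
    exact hxgen (isGenericPoint_of_isClosedEmbedding hjci.isClosedEmbedding h3)
  -- the model point step (K3)
  obtain ⟨U, s, X'', τ, j₂, t₂, hU, hs, hss₀, hsU, hτ, hCh'', hreg'', hnoeth'', hint'', hdom'', hsq₂, hcomm, hsets⟩ :=
    modelPointStep O k θ hθ P q Y hY Ch hStep X' σ' S' hCh hreg hproper hdom F₁ j t hsq T₁ hTS xF hx hFreg hxT hTx hw F₂ υ hυ
  -- downstairs: `F₂` integral, `T₂` irreducible
  have hDne : (vanishingIdeal ⟨{xF}, hx⟩ : F₁.IdealSheafData) ≠ ⊥ := by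
    intro h
    apply hTx
    intro y _
    have : y ∈ ((vanishingIdeal ⟨{xF}, hx⟩ : F₁.IdealSheafData).support : Set F₁) := by
      rw [h, Scheme.IdealSheafData.support_bot]; trivial
    rwa [coe_support_vanishingIdeal] at this
  haveI hF₂ : IsIntegral F₂ := hυ.isIntegral hDne
  haveI hj₂ci : IsClosedImmersion j₂ := MorphismProperty.IsStableUnderBaseChange.of_isPullback hsq₂.flip inferInstance
  have hT₂irr : IsIrreducible (closure (υ ⁻¹' (T₁ \ {xF}))) :=
    isIrreducible_of_model hYirr hYcl (hChain _ _ _ hCh'') j₂ _ isClosed_closure hsets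
  -- the section: support over non-generic points of `Y`; the carrier identity
  haveI : IsSeparated (σ' ≫ q) := inferInstance
  obtain ⟨_, -, -, hCsupp⟩ := section_isClosedImmersion_and_isRegular_ker O X' (σ' ≫ q) s hs
  have hrs : ∀ p' : Spec (.of O), (σ' ≫ q) (s p') = p' := fun p' => by
    rw [← Scheme.Hom.comp_apply, hs]; rfl
  have hoffs : ∀ c ∈ (s.ker.support : Set X'), ¬ IsGenericPoint (σ' c) Y := by
    intro c hc hgen
    rw [hCsupp] at hc
    obtain ⟨p', rfl⟩ := hc
    have hp' : p' = IsLocalRing.closedPoint O := by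
      rw [← hrs p']
      show (σ' ≫ q) (s p') = _
      rw [Scheme.Hom.comp_apply]
      exact hY hgen.mem
    rw [hp', hss₀] at hgen
    exact hw hgen
  have hrangej : Set.range (j ≫ σ' ≫ q) ⊆ {IsLocalRing.closedPoint O} := by
    rintro _ ⟨y, rfl⟩
    have : j y ∈ Set.range j := ⟨y, rfl⟩
    rw [range_eq_preimage_of_isPullback hsq, range_specMap_of_surjective_of_field θ hθ] at this
    simpa using this
  have hCD : s.ker.comap j = vanishingIdeal ⟨{xF}, hx⟩ :=
    ker_section_comap_eq_vanishingIdeal O X' F₁ (σ' ≫ q) s hs j hrangej xF hss₀.symm hx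
  have hE : (s.ker.comap τ).comap j₂ = (vanishingIdeal ⟨{xF}, hx⟩ : F₁.IdealSheafData).comap υ := by
    rw [← hCD, ← Scheme.IdealSheafData.comap_comp, ← Scheme.IdealSheafData.comap_comp, hcomm]
  refine ⟨hF₂, hT₂irr, U, s, X'', τ, j₂, t₂, hproper, hU, hs, hsU, hoffs, hτ, hE, ?_, hint'', hnoeth'', hreg'', hdom'', hsq₂⟩
  rw [hsets]; exact hCh''

/-! ## The same with the full export -/

/-- **THE MODEL POINT STEP, chain currency, full export** — `modelPointStep_chain` with, in addition, the position of the
section (`s(𝔪) = j x`) and the commutation of the two model squares (`j₂ ≫ τ = υ ≫ j`), as consumed by the lift hypothesis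
`HΔ` of T-ISO-0⁺. [cite: Liu2002, §8.1 and Thm. 8.1.19] -/
theorem modelPointStep_chain' (O : Type) [CommRing O] [IsDomain O] [IsDiscreteValuationRing O]
    [IsAdicComplete (IsLocalRing.maximalIdeal O) O] [IsAlgClosed (IsLocalRing.ResidueField O)]
    (k : Type) [Field k] (θ : O →+* k) (hθ : Function.Surjective θ)
    (P : Scheme.{0}) (q : P ⟶ Spec (.of O)) (Y : Set P) (hY : Y ⊆ q ⁻¹' {IsLocalRing.closedPoint O})
    (hYirr : IsIrreducible Y) (hYcl : IsClosed Y) (hPnoeth : IsLocallyNoetherian P) (hPreg : Scheme.IsRegular P) [IsProper q]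
    (Ch : ∀ X' : Scheme.{0}, (X' ⟶ P) → Set X' → Prop)
    (hChain : ∀ (X' : Scheme.{0}) (σ : X' ⟶ P) (S : Set X'), Ch X' σ S → Chain P Y X' σ S)
    (hStep : ∀ (X' X'' : Scheme.{0}) (σ' : X' ⟶ P) (S' : Set X') (C : X'.IdealSheafData) (τ : X'' ⟶ X'),
      Ch X' σ' S' → IsBlowup τ C → Scheme.IsRegular C.subscheme → Flat (C.subschemeι ≫ σ' ≫ q) →
      σ' '' (C.support : Set X') ⊆ {x : P | ¬ IsGenericPoint x Y} →
      (C.support : Set X') ∩ (σ' ≫ q) ⁻¹' {IsLocalRing.closedPoint O} ⊆ S' →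
      Ch X'' (τ ≫ σ') (closure (τ ⁻¹' (S' \ (C.support : Set X')))))
    -- the upstairs stage
    (X' : Scheme.{0}) (σ' : X' ⟶ P) (S' : Set X') (hCh : Ch X' σ' S')
    [IsIntegral X'] [IsLocallyNoetherian X'] (hreg : Scheme.IsRegular X') (hdom : IsDominant (σ' ≫ q))
    -- the downstairs stage and the model square
    (F₁ : Scheme.{0}) [IsIntegral F₁] (j : F₁ ⟶ X') (t : F₁ ⟶ Spec (.of k))
    (hsq : IsPullback j t (σ' ≫ q) (Spec.map (CommRingCat.ofHom θ)))
    (T₁ : Set F₁) (hT₁cl : IsClosed T₁) (hT₁irr : IsIrreducible T₁) (hTS : j '' T₁ = S')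
    -- the point
    (x : ↥(vanishingIdeal (⟨closure T₁, isClosed_closure⟩ : Closeds F₁)).subscheme)
    (hx : IsClosed ({((vanishingIdeal (⟨closure T₁, isClosed_closure⟩ : Closeds F₁)).subschemeι x : F₁)} : Set F₁))
    (hxreg : ¬ IsRegularLocalRing ((vanishingIdeal (⟨closure T₁, isClosed_closure⟩ : Closeds F₁)).subscheme.presheaf.stalk x))
    (hFreg : IsRegularLocalRing (F₁.presheaf.stalk ((vanishingIdeal (⟨closure T₁, isClosed_closure⟩ : Closeds F₁)).subschemeι x)))
    -- the downstairs blow-up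
    (F₂ : Scheme.{0}) (υ : F₂ ⟶ F₁)
    (hυ : IsBlowup υ (vanishingIdeal ⟨{((vanishingIdeal (⟨closure T₁, isClosed_closure⟩ : Closeds F₁)).subschemeι x : F₁)}, hx⟩)) :
    IsIntegral F₂ ∧
    IsIrreducible (closure (υ ⁻¹' (T₁ \ {((vanishingIdeal (⟨closure T₁, isClosed_closure⟩ :
      Closeds F₁)).subschemeι x : F₁)}))) ∧
    ∃ (U : X'.Opens) (s : Spec (.of O) ⟶ X') (X'' : Scheme.{0}) (τ : X'' ⟶ X') (j₂ : F₂ ⟶ X'') (t₂ : F₂ ⟶ Spec (.of k)),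
      IsProper (σ' ≫ q) ∧ Smooth (U.ι ≫ σ' ≫ q) ∧ s ≫ σ' ≫ q = 𝟙 _ ∧ s (IsLocalRing.closedPoint O) ∈ U ∧
      s (IsLocalRing.closedPoint O) = j ((vanishingIdeal (⟨closure T₁, isClosed_closure⟩ : Closeds F₁)).subschemeι x) ∧
      (∀ c ∈ (s.ker.support : Set X'), ¬ IsGenericPoint (σ' c) Y) ∧
      IsBlowup τ s.ker ∧ j₂ ≫ τ = υ ≫ j ∧
      (s.ker.comap τ).comap j₂ = (vanishingIdeal ⟨{((vanishingIdeal (⟨closure T₁, isClosed_closure⟩ :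
        Closeds F₁)).subschemeι x : F₁)}, hx⟩).comap υ ∧
      Ch X'' (τ ≫ σ') (j₂ '' closure (υ ⁻¹' (T₁ \ {((vanishingIdeal (⟨closure T₁, isClosed_closure⟩ :
        Closeds F₁)).subschemeι x : F₁)}))) ∧
      IsIntegral X'' ∧ IsLocallyNoetherian X'' ∧ Scheme.IsRegular X'' ∧ IsDominant ((τ ≫ σ') ≫ q) ∧
      IsPullback j₂ t₂ ((τ ≫ σ') ≫ q) (Spec.map (CommRingCat.ofHom θ)) := by
  classical
  set xF : F₁ := (vanishingIdeal (⟨closure T₁, isClosed_closure⟩ : Closeds F₁)).subschemeι x with hxF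
  have hclT₁ : closure T₁ = T₁ := hT₁cl.closure_eq
  have hT₁irr' : IsIrreducible (closure T₁) := by rw [hclT₁]; exact hT₁irr
  haveI : IsClosedImmersion (Spec.map (CommRingCat.ofHom θ)) := IsClosedImmersion.spec_of_surjective _ hθ
  -- `xF ∈ T₁` is not the generic point of `T₁`
  have hrangeι : Set.range (vanishingIdeal (⟨closure T₁, isClosed_closure⟩ : Closeds F₁)).subschemeι = closure T₁ := by
    rw [range_subschemeι, coe_support_vanishingIdeal]; rfl
  have hxT : xF ∈ T₁ := by
    rw [← hclT₁, ← hrangeι]; exact ⟨x, rfl⟩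
  have hxgen : ¬ IsGenericPoint xF T₁ := by
    have h := not_isGenericPoint_of_not_isRegularLocalRing (⟨closure T₁, isClosed_closure⟩ : Closeds F₁) hT₁irr' x hxreg
    rwa [show ((⟨closure T₁, isClosed_closure⟩ : Closeds F₁) : Set F₁) = T₁ from hclT₁] at h
  have hTx : ¬ T₁ ⊆ {xF} := not_subset_singleton_of_not_isGenericPoint hT₁cl hxT hxgen
  -- upstairs chain facts
  have hch : Chain P Y X' σ' S' := hChain _ _ _ hCh
  obtain ⟨-, -, hσ'⟩ := chain_isRegular P Y X' σ' S' hch hPnoeth hPreg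
  haveI := hσ'
  have hproper : IsProper (σ' ≫ q) := inferInstance
  haveI hjci : IsClosedImmersion j := MorphismProperty.IsStableUnderBaseChange.of_isPullback hsq.flip inferInstance
  -- `σ' (j xF)` is not the generic point of `Y`
  obtain ⟨ξ, hξ⟩ : ∃ ξ : P, IsGenericPoint ξ Y := QuasiSober.sober hYirr hYcl
  obtain ⟨ξ', hfib', hS'⟩ := Chain.fibre hch hξ
  have hw : ¬ IsGenericPoint (σ' (j xF)) Y := by
    intro hgen
    have h1 : σ' (j xF) = ξ := hgen.eq hξ
    have h2 : j xF = ξ' := by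
      have : j xF ∈ σ' ⁻¹' {ξ} := h1
      rw [hfib'] at this
      simpa using this
    have h3 : IsGenericPoint (j xF) (j '' T₁) := by
      rw [hTS, h2, isGenericPoint_def, hS']
    exact hxgen (isGenericPoint_of_isClosedEmbedding hjci.isClosedEmbedding h3)
  -- the model point step (K3)
  obtain ⟨U, s, X'', τ, j₂, t₂, hU, hs, hss₀, hsU, hτ, hCh'', hreg'', hnoeth'', hint'', hdom'', hsq₂, hcomm, hsets⟩ :=
    modelPointStep O k θ hθ P q Y hY Ch hStep X' σ' S' hCh hreg hproper hdom F₁ j t hsq T₁ hTS xF hx hFreg hxT hTx hw F₂ υ hυ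
  -- downstairs: `F₂` integral, `T₂` irreducible
  have hDne : (vanishingIdeal ⟨{xF}, hx⟩ : F₁.IdealSheafData) ≠ ⊥ := by
    intro h
    apply hTx
    intro y _
    have : y ∈ ((vanishingIdeal ⟨{xF}, hx⟩ : F₁.IdealSheafData).support : Set F₁) := by
      rw [h, Scheme.IdealSheafData.support_bot]; trivial
    rwa [coe_support_vanishingIdeal] at this
  haveI hF₂ : IsIntegral F₂ := hυ.isIntegral hDne
  haveI hj₂ci : IsClosedImmersion j₂ := MorphismProperty.IsStableUnderBaseChange.of_isPullback hsq₂.flip inferInstance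
  have hT₂irr : IsIrreducible (closure (υ ⁻¹' (T₁ \ {xF}))) :=
    isIrreducible_of_model hYirr hYcl (hChain _ _ _ hCh'') j₂ _ isClosed_closure hsets
  -- the section: support over non-generic points of `Y`; the carrier identity
  haveI : IsSeparated (σ' ≫ q) := inferInstance
  obtain ⟨_, -, -, hCsupp⟩ := section_isClosedImmersion_and_isRegular_ker O X' (σ' ≫ q) s hs
  have hrs : ∀ p' : Spec (.of O), (σ' ≫ q) (s p') = p' := fun p' => by
    rw [← Scheme.Hom.comp_apply, hs]; rfl
  have hoffs : ∀ c ∈ (s.ker.support : Set X'), ¬ IsGenericPoint (σ' c) Y := by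
    intro c hc hgen
    rw [hCsupp] at hc
    obtain ⟨p', rfl⟩ := hc
    have hp' : p' = IsLocalRing.closedPoint O := by
      rw [← hrs p']
      show (σ' ≫ q) (s p') = _
      rw [Scheme.Hom.comp_apply]
      exact hY hgen.mem
    rw [hp', hss₀] at hgen
    exact hw hgen
  have hrangej : Set.range (j ≫ σ' ≫ q) ⊆ {IsLocalRing.closedPoint O} := by
    rintro _ ⟨y, rfl⟩
    have : j y ∈ Set.range j := ⟨y, rfl⟩
    rw [range_eq_preimage_of_isPullback hsq, range_specMap_of_surjective_of_field θ hθ] at this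
    simpa using this
  have hCD : s.ker.comap j = vanishingIdeal ⟨{xF}, hx⟩ :=
    ker_section_comap_eq_vanishingIdeal O X' F₁ (σ' ≫ q) s hs j hrangej xF hss₀.symm hx
  have hE : (s.ker.comap τ).comap j₂ = (vanishingIdeal ⟨{xF}, hx⟩ : F₁.IdealSheafData).comap υ := by
    rw [← hCD, ← Scheme.IdealSheafData.comap_comp, ← Scheme.IdealSheafData.comap_comp, hcomm]
  refine ⟨hF₂, hT₂irr, U, s, X'', τ, j₂, t₂, hproper, hU, hs, hsU, hss₀, hoffs, hτ, hcomm, hE, ?_, hint'', hnoeth'', hreg'', hdom'',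
    hsq₂⟩
  rw [hsets]; exact hCh''

end Summit.ResolutionOfSingularities.ResolutionOfSingularities.Cruxes.EquisingularLiftNat.Sections

end
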